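import Literature.AlgebraicTopology.Homotopy.CWTypeCompactBoundaryProofs
import Mathlib.Analysis.SpecialFunctions.Complex.Circle
import Mathlib.Geometry.Manifold.Instances.Sphere
import Mathlib.Topology.UnitInterval
import HarnessLib

/-!
# Normed spaces, boundaryless manifolds, spheres and circles are strongly locally contractible

Topic `Literature/AlgebraicTopology/Homotopy`, complements to `CWTypeCompactBoundaryProofs.lean`
(`Convex.stronglyLocallyContractibleSpace`, `ChartedSpace.stronglyLocallyContractibleSpace`) and
`NeighbourhoodRetract.lean` (`locallyContractibleSpace_of_chartedSpace`, the classical notion):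
in Mathlib's STRONG sense (`StronglyLocallyContractibleSpace`: contractible neighbourhoods form
a basis; Hatcher 2002, proof of Cor. A.9, "Manifolds are locally contractible"),

* `stronglyLocallyContractibleSpace_of_normedSpace` — every real normed space (it is convex);
* `stronglyLocallyContractibleSpace_of_chartedSpace_normedSpace` — every space with an atlas of
  charts into a real normed space, e.g. boundaryless topological manifolds
  (`ChartedSpace (EuclideanSpace ℝ (Fin n)) M`), the spheres `Metric.sphere 0 1` and Mathlib's
  `Circle`;
* `stronglyLocallyContractibleSpace_addCircle` — the circles `AddCircle p = ℝ/pℤ`, `p ≠ 0`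
  (homeomorphic to `Circle`, Mathlib's `AddCircle.homeomorphCircle`);
* `stronglyLocallyContractibleSpace_unitInterval`, `…_Icc` — intervals (convex);
* hence (Mathlib's product instance and `StronglyLocallyContractibleSpace.locallyContractible`)
  products such as `F × S¹`, `F × I²` of such spaces are locally contractible in the classical
  sense consumed by the ENR theorem (`locallyContractibleSpace_prod_addCircle`,
  `locallyContractibleSpace_prod_unitInterval_sq`).

Everything is proved, stated as `theorem`s (no global instances from a proof file; use `haveI`).

## References

* A. Hatcher, *Algebraic Topology*, CUP (2002), Appendix, Cor. A.9 and its proof ("Manifolds are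
  locally contractible"). [HatcherAT2002]
-/

noncomputable section

open Set
open scoped unitInterval

namespace Literature.AlgebraicTopology.Homotopy

/-- **Real normed spaces are strongly locally contractible** (they are convex:
`Convex.stronglyLocallyContractibleSpace` for `univ`, transported along `E ≃ₜ ↥univ`).
[cite: HatcherAT2002, Cor. A.9 (proof)] -/
theorem stronglyLocallyContractibleSpace_of_normedSpace (E : Type*) [NormedAddCommGroup E]
    [NormedSpace ℝ E] : StronglyLocallyContractibleSpace E := by
  haveI := (convex_univ : Convex ℝ (univ : Set E)).stronglyLocallyContractibleSpace
  exact (Homeomorph.Set.univ E).symm.isOpenEmbedding.stronglyLocallyContractibleSpace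

/-- **Spaces with an atlas of charts into a real normed space are strongly locally contractible**
— boundaryless topological manifolds (`H = EuclideanSpace ℝ (Fin n)`), in particular the spheres
`Metric.sphere (0 : EuclideanSpace ℝ (Fin (n+1))) 1` and Mathlib's `Circle` (Hatcher 2002, proof
of Cor. A.9: "Manifolds are locally contractible"). [cite: HatcherAT2002, Cor. A.9 (proof)] -/
theorem stronglyLocallyContractibleSpace_of_chartedSpace_normedSpace (H : Type*)
    [NormedAddCommGroup H] [NormedSpace ℝ H] (M : Type*) [TopologicalSpace M] [ChartedSpace H M] :
    StronglyLocallyContractibleSpace M := by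
  haveI := stronglyLocallyContractibleSpace_of_normedSpace H
  exact ChartedSpace.stronglyLocallyContractibleSpace H M

/-- **Mathlib's unit circle `Circle ⊂ ℂ` is strongly locally contractible** (a manifold modelled
on `ℝ¹`). [cite: HatcherAT2002, Cor. A.9 (proof)] -/
theorem stronglyLocallyContractibleSpace_circle : StronglyLocallyContractibleSpace Circle :=
  stronglyLocallyContractibleSpace_of_chartedSpace_normedSpace (EuclideanSpace ℝ (Fin 1)) Circle

/-- **The circles `ℝ/pℤ = AddCircle p` (`p ≠ 0`) are strongly locally contractible**
(homeomorphic to `Circle`: Mathlib's `AddCircle.homeomorphCircle`).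
[cite: HatcherAT2002, Cor. A.9 (proof)] -/
theorem stronglyLocallyContractibleSpace_addCircle {p : ℝ} (hp : p ≠ 0) :
    StronglyLocallyContractibleSpace (AddCircle p) := by
  haveI := stronglyLocallyContractibleSpace_circle
  exact (AddCircle.homeomorphCircle hp).isOpenEmbedding.stronglyLocallyContractibleSpace

/-- Closed intervals of `ℝ` are strongly locally contractible (convex). [folklore] -/
theorem stronglyLocallyContractibleSpace_Icc (a b : ℝ) :
    StronglyLocallyContractibleSpace ↥(Icc a b) :=
  (convex_Icc a b).stronglyLocallyContractibleSpace

/-- The unit interval `I = [0, 1]` is strongly locally contractible (convex). [folklore] -/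
theorem stronglyLocallyContractibleSpace_unitInterval : StronglyLocallyContractibleSpace I :=
  stronglyLocallyContractibleSpace_Icc 0 1

/-- **`F × S¹` is locally contractible** (classical sense, as consumed by the ENR theorem) for a
strongly locally contractible `F`, e.g. a closed surface times the circle `ℝ/ℤ` — the boundary
`Σ × S¹` of a tubular neighbourhood of a surface in a 4-manifold. [cite: HatcherAT2002, Cor. A.9 (proof)] -/
theorem locallyContractibleSpace_prod_addCircle (F : Type*) [TopologicalSpace F]
    [StronglyLocallyContractibleSpace F] {p : ℝ} (hp : p ≠ 0) :
    LocallyContractibleSpace (F × AddCircle p) := by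
  haveI := stronglyLocallyContractibleSpace_addCircle hp
  exact StronglyLocallyContractibleSpace.locallyContractible

/-- **`F × I²` is locally contractible** for a strongly locally contractible `F`, e.g. a closed
surface times a square — a closed tubular neighbourhood `Σ × D²`, `D² ≅ I²`. [cite: HatcherAT2002, Cor. A.9 (proof)] -/
theorem locallyContractibleSpace_prod_unitInterval_sq (F : Type*) [TopologicalSpace F]
    [StronglyLocallyContractibleSpace F] : LocallyContractibleSpace (F × (I × I)) := by
  haveI := stronglyLocallyContractibleSpace_unitInterval
  exact StronglyLocallyContractibleSpace.locallyContractible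

end Literature.AlgebraicTopology.Homotopy
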